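import Summits.HodgeConjecture.HodgeConjecture.Theorems.Ring2WeilCoverageDicyclicPlacement
import Summits.HodgeConjecture.HodgeConjecture.Theorems.Ring2WeilCoverageNormTableC
import HarnessLib

/-!
# Weil-type family coverage — dicyclic placement B: the `Dic₁₁` / `Dic₁₃` triangle-curve CM points (primes `11`, `13`)

research route conditional on HC_CM; not a corollary; Q11.4-sentence-2 already refuted in dim ≥ 3.

Ring 2, WEIL-TYPE FAMILY-COVERAGE CENSUS (`HOME/WEIL-FAMILY-COVERAGE.md` `## b04`, block b04.9 «GROUP-PRYM PLACEMENT round 3: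
THEOREM T″, the dicyclic parity theorem, and the `Dic_n` triangle curves `y² = x(x^{2n} - 1)` as Fermat quotients», owner ring2-b04).
For an odd prime `p` the hyperelliptic curve `C_p : y² = x(x^{2p} - 1)` (genus `p`; signature `(0; 4, 4, 2p)` for
`Dic_p ⊂ Aut C_p`; `=` the superelliptic Fermat quotient `w^{4p} = t(t - 1)^{2p}`) has `J(C_p) ~ E_i × P_p` with `P_p` a CM
abelian variety of dimension `p - 1` carrying the definite quaternion algebra `D_p = (η² - 4, -1)_{ℚ(ζ_p)⁺}`; the restricted
principal polarisation has type `(1^{p-2}, p)` (THEOREM T: `v_p = g(C_p/⟨a²⟩) - g(C_p/⟨a⟩) = 1 - 0`, `v₂ = 0`; engine-certified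
for `p = 5, 7, 11, 13`), so by the placement law the Weil structure `(P_p, K)` for an imaginary quadratic `K = ℚ(x) ⊂ D_p` with a
NORM frame index lies on the class `[p]`: NON-split iff `p` is not a norm from `K`.  This file decides the classes met:

* §1 `K = ℚ(√-3)`, primes `2`, `11`: `two_pow_mul_three_pow_mul_eleven_pow_mem_iff` (`↔ α, ε` even; `2`, `11`, `22 ∉ Nm`, `3 ∈ Nm`)
  — the `Dic₁₁` CM TENFOLD of type `(1⁹, 11)` lies on `W10.3.11 = (5, ℚ(√-3), [-11])`, `T = {3, 11}`;
* §2 `K = ℚ(√-2)`, prime `13`: `two_pow_mul_three_pow_mul_thirteen_pow_mem_iff` (`↔ ε` even; `2`, `3 ∈ Nm`, `13` inert) — the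
  `Dic₁₃` CM TWELVEFOLD of type `(1¹¹, 13)` WOULD lie on `W12.2.13 = (6, ℚ(√-2), [+13])` under a norm-index integral frame
  (ERRATUM E-b04.9-1, ring2-b04 g46, census b04.10 (B): NO such frame exists — local obstruction at `13` — and the frame-free class
  is SPLIT, row `W12.2.1`; the theorem below is a correct conditional);
* §3 `K = ℚ(√-7)`, primes `3`, `13`: `two_pow_mul_three_pow_mul_thirteen_pow_mem_iff` (`↔ β, ε` even; `3`, `13`, `39 ∉ Nm`) —
  «`W12.7.13`» under the same (unmet) hypothesis; frame-free: `W12.7.1` (E-b04.9-1);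
* §4 the census sentences over part A's bridge with a NORM index (`…_of_index_mem`), including `K = ℚ(i)` with the prime `11`
  (`SqrtNeg1.two_pow_mul_eleven_pow_mem_iff` of cyclic placement B): the `Dic₁₁` tenfold via `x = b` (`ℤ[b] = ℤ[i]`; engine frame
  index `2 ∈ Nm`) lies on `W10.1.11 = (5, ℚ(i), [-11])`.

All norm facts are REUSED BY NAME (ring2-b02 `Ring2WeilNormObstructionDescentCensus`: `two/eleven/twentyTwo_not_mem_norm_three`,
`thirteen_not_mem_norm_two`, `three/thirteen_not_mem_norm_seven`; ring2-b04 g40 tables `SqrtNeg3.mem_3`, `SqrtNeg2.mem_2/mem_3`,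
`SqrtNeg7.mem_2`, `SqrtNeg7.not_mem_39`, `SqrtNeg1.mem_2`).  No `def`, no named fact, no `sorry`; nothing here is a statement
about Hodge classes; `HC_CM` is used nowhere.

References: [cite: vanGeemen1994HodgeAV, 5.4 and (5.4.1)]; [cite: Serre1973, Ch. III §1].
-/

set_option linter.dupNamespace false

open Matrix
open Literature.AlgebraicGeometry.Motives (normUnitsSubgroup)
open Literature.AlgebraicGeometry.VanGeemen1994
open Literature.Geometry.Kaehler.ComplexTorus
open Summit.HodgeConjecture.HodgeConjecture.Ring2.Hypotheses
open Summit.HodgeConjecture.HodgeConjecture.Ring2.AbelianAll (weilStdGramMatrix)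
open Summit.HodgeConjecture.Ring2WeilNormDescent

namespace Summit.HodgeConjecture.HodgeConjecture.Ring2.WeilCoverage

/-! ### §1 `K = ℚ(√-3)` with the primes `2` and `11` -/

namespace SqrtNeg3

/-- `2^α · 3^β · 11^ε ∈ Nm(ℚ(√-3)ˣ) ↔ α` and `ε` both even (`3 = Nm √-3` is a norm; `2`, `11` are inert, `22 ∉ Nm`: the classes
`[2]` (`T = {2,3}`, R1), `[11]` (`T = {3,11}`), `[22]` (`T = {2,11}`) are distinct): the `Dic₁₁` CM tenfold of type `(1⁹, 11)`
(the `D₁₁`-part of `y² = x(x²² - 1)`) lies on the NON-split row `W10.3.11 = (5, ℚ(√-3), [-11])`.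
research route conditional on HC_CM; not a corollary; Q11.4-sentence-2 already refuted in dim ≥ 3. [cite: vanGeemen1994HodgeAV, (5.4.1)] -/
theorem two_pow_mul_three_pow_mul_eleven_pow_mem_iff (α β ε : ℕ) :
    Units.mk0 ((2 : ℚ) ^ α * 3 ^ β * 11 ^ ε)
        (mul_ne_zero (mul_ne_zero (pow_ne_zero α two_ne_zero) (pow_ne_zero β three_ne_zero))
          (pow_ne_zero ε (by norm_num))) ∈ normUnitsSubgroup ℚ (weilField 3) ↔ Even α ∧ Even ε := by
  have e : Units.mk0 ((2 : ℚ) ^ α * 3 ^ β * 11 ^ ε)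
        (mul_ne_zero (mul_ne_zero (pow_ne_zero α two_ne_zero) (pow_ne_zero β three_ne_zero))
          (pow_ne_zero ε (by norm_num))) =
      Units.mk0 ((3 : ℚ) ^ β) (pow_ne_zero β three_ne_zero) *
        Units.mk0 ((2 : ℚ) ^ α * 11 ^ ε) (mul_ne_zero (pow_ne_zero α two_ne_zero) (pow_ne_zero ε (by norm_num))) :=
    Units.ext (by simp only [Units.val_mul, Units.val_mk0]; ring)
  rw [e, pow_mul_mem_iff_of_mem _ mem_3]
  have h22 : Units.mk0 ((11 : ℚ) * 2) (mul_ne_zero (by norm_num) two_ne_zero) ∉ normUnitsSubgroup ℚ (weilField 3) := by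
    have e22 : Units.mk0 ((11 : ℚ) * 2) (mul_ne_zero (by norm_num) two_ne_zero) = Units.mk0 (22 : ℚ) (by norm_num) :=
      Units.ext (by simp only [Units.val_mk0]; norm_num)
    rw [e22]
    exact twentyTwo_not_mem_norm_three
  exact pow_mul_pow_mem_iff_of_not_mem two_ne_zero (by norm_num) two_not_mem_norm_three eleven_not_mem_norm_three h22 α ε

end SqrtNeg3

/-! ### §2 `K = ℚ(√-2)` with the prime `13` -/

namespace SqrtNeg2

/-- `2^α · 3^β · 13^ε ∈ Nm(ℚ(√-2)ˣ) ↔ ε` even (`2 = 0² + 2·1²`, `3 = 1² + 2·1²` are norms; `13` is inert in `ℚ(√-2)`): the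
`Dic₁₃` CM twelvefold of type `(1¹¹, 13)` (the `D₁₃`-part of `y² = x(x²⁶ - 1)`) would lie on `W12.2.13 = (6, ℚ(√-2), [+13])`,
`T = {2, 13}`, IF it had a norm-index integral `ℚ(√-2)`-frame — it has none (ERRATUM E-b04.9-1: frame-free class SPLIT, `W12.2.1`,
census b04.10 (B)); the norm statement itself is unconditional.
research route conditional on HC_CM; not a corollary; Q11.4-sentence-2 already refuted in dim ≥ 3. [cite: vanGeemen1994HodgeAV, (5.4.1)] -/
theorem two_pow_mul_three_pow_mul_thirteen_pow_mem_iff (α β ε : ℕ) :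
    Units.mk0 ((2 : ℚ) ^ α * 3 ^ β * 13 ^ ε)
        (mul_ne_zero (mul_ne_zero (pow_ne_zero α two_ne_zero) (pow_ne_zero β three_ne_zero))
          (pow_ne_zero ε (by norm_num))) ∈ normUnitsSubgroup ℚ (weilField 2) ↔ Even ε := by
  have e : Units.mk0 ((2 : ℚ) ^ α * 3 ^ β * 13 ^ ε)
        (mul_ne_zero (mul_ne_zero (pow_ne_zero α two_ne_zero) (pow_ne_zero β three_ne_zero))
          (pow_ne_zero ε (by norm_num))) =
      Units.mk0 ((2 : ℚ) ^ α) (pow_ne_zero α two_ne_zero) *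
        (Units.mk0 ((3 : ℚ) ^ β) (pow_ne_zero β three_ne_zero) *
          Units.mk0 ((13 : ℚ) ^ ε) (pow_ne_zero ε (by norm_num))) :=
    Units.ext (by simp only [Units.val_mul, Units.val_mk0]; ring)
  rw [e, pow_mul_mem_iff_of_mem _ mem_2, pow_mul_mem_iff_of_mem _ mem_3]
  exact pow_mem_normUnitsSubgroup_iff_even _ thirteen_not_mem_norm_two ε

end SqrtNeg2

/-! ### §3 `K = ℚ(√-7)` with the primes `3` and `13` -/

namespace SqrtNeg7

/-- `2^α · 3^β · 13^ε ∈ Nm(ℚ(√-7)ˣ) ↔ β` and `ε` both even (`2 = Nm((1+√-7)/2)` is a norm; `3`, `13` inert, `39 ∉ Nm`: the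
classes `[3]` (`T = {3,7}`), `[13]` (`T = {7,13}`), `[39]` (`T = {3,13}`) are distinct); the placement sentence «the `Dic₁₃` CM
twelvefold lies on `W12.7.13`» of gen 45 is WITHDRAWN (ERRATUM E-b04.9-1: no norm-index frame; frame-free class SPLIT, `W12.7.1`).
research route conditional on HC_CM; not a corollary; Q11.4-sentence-2 already refuted in dim ≥ 3. [cite: vanGeemen1994HodgeAV, (5.4.1)] -/
theorem two_pow_mul_three_pow_mul_thirteen_pow_mem_iff (α β ε : ℕ) :
    Units.mk0 ((2 : ℚ) ^ α * 3 ^ β * 13 ^ ε)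
        (mul_ne_zero (mul_ne_zero (pow_ne_zero α two_ne_zero) (pow_ne_zero β three_ne_zero))
          (pow_ne_zero ε (by norm_num))) ∈ normUnitsSubgroup ℚ (weilField 7) ↔ Even β ∧ Even ε := by
  have e : Units.mk0 ((2 : ℚ) ^ α * 3 ^ β * 13 ^ ε)
        (mul_ne_zero (mul_ne_zero (pow_ne_zero α two_ne_zero) (pow_ne_zero β three_ne_zero))
          (pow_ne_zero ε (by norm_num))) =
      Units.mk0 ((2 : ℚ) ^ α) (pow_ne_zero α two_ne_zero) *
        Units.mk0 ((3 : ℚ) ^ β * 13 ^ ε) (mul_ne_zero (pow_ne_zero β three_ne_zero) (pow_ne_zero ε (by norm_num))) :=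
    Units.ext (by simp only [Units.val_mul, Units.val_mk0]; ring)
  rw [e, pow_mul_mem_iff_of_mem _ mem_2]
  have h39 : Units.mk0 ((13 : ℚ) * 3) (mul_ne_zero (by norm_num) three_ne_zero) ∉ normUnitsSubgroup ℚ (weilField 7) := by
    have e39 : Units.mk0 ((13 : ℚ) * 3) (mul_ne_zero (by norm_num) three_ne_zero) = Units.mk0 (39 : ℚ) (by norm_num) :=
      Units.ext (by simp only [Units.val_mk0]; norm_num)
    rw [e39]
    exact not_mem_39
  exact pow_mul_pow_mem_iff_of_not_mem three_ne_zero (by norm_num) three_not_mem_norm_seven thirteen_not_mem_norm_seven h39 β ε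

end SqrtNeg7

/-! ### §4 Census sentences for the `Dic₁₁` / `Dic₁₃` triangle-curve CM points -/

section Census

variable {ι : Type*} {E : Type*} [NormedAddCommGroup E] [NormedSpace ℂ E]
  {Φ : (ι → ℝ) ≃L[ℝ] E} {ω : E [⋀^Fin 2]→L[ℝ] ℝ} {g : ℕ} {dtyp : Fin g → ℕ}
  {n : ℕ} {q : ℚ}

/-- **`K = ℚ(i)`, type `2^α 11^ε`, frame index a NORM (e.g. `x = b ∈ Dic₁₁`, engine frame index `2 = Nm(1+i)`): SPLIT iff
`ε = v₁₁(d₁⋯d_g)` even** — the `Dic₁₁` CM tenfold `P₁₁ ⊂ J(y² = x(x²² - 1))` has type `(1⁹, 11)`, `ε = 1` ⟹ NON-split row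
`W10.1.11 = (5, ℚ(i), [-11])`: a CM point WITH A CURVE on a class-`11` tenfold row.
research route conditional on HC_CM; not a corollary; Q11.4-sentence-2 already refuted in dim ≥ 3. [cite: vanGeemen1994HodgeAV, (5.4.1)] -/
theorem sqrtNeg1_mk_det_eq_split_iff_even_of_type_two_eleven
    {a b : Matrix (Fin (2 * n)) (Fin (2 * n)) ℚ} (hd : IsPolarizationType Φ ω dtyp)
    (e : Fin (4 * n) ≃ ι) (P : Matrix (Fin (4 * n)) (Fin (4 * n)) ℤ)
    (hF : (Matrix.of fun j j' =>
        ω ![Φ (intVec fun i => P (e.symm i) j), Φ (intVec fun i => P (e.symm i) j')]) =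
      (weilStdGramMatrix n 1 a b).map (Rat.cast : ℚ → ℝ))
    (ha : a.IsSymm) (hb : bᵀ = -b) (hq : (weilGramMatrix 1 a b).det = algebraMap ℚ (weilField 1) q)
    (hsign : 0 < (-1 : ℚ) ^ n * q) (hq0 : q ≠ 0) (hP : (P.det.natAbs : ℚ) ≠ 0)
    (hidx : Units.mk0 (P.det.natAbs : ℚ) hP ∈ normUnitsSubgroup ℚ (weilField 1))
    {α ε : ℕ} (htyp : (∏ i, (dtyp i : ℚ)) = 2 ^ α * 11 ^ ε) :
    (QuotientGroup.mk (Units.mk0 q hq0) : weilNormResidueGroup 1) = splitDiscriminantClass n 1 ↔ Even ε := by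
  have hne : (2 : ℚ) ^ α * 11 ^ ε ≠ 0 := mul_ne_zero (pow_ne_zero α two_ne_zero) (pow_ne_zero ε (by norm_num))
  have hprod : (∏ i, (dtyp i : ℚ)) ≠ 0 := by rw [htyp]; exact hne
  rw [mk_det_eq_splitDiscriminantClass_iff_prod_type_mem_of_index_mem hd (by norm_num) e P hF ha hb hq hsign
    hq0 hP hidx hprod]
  have hu : Units.mk0 (∏ i, (dtyp i : ℚ)) hprod = Units.mk0 ((2 : ℚ) ^ α * 11 ^ ε)
      (mul_ne_zero (pow_ne_zero α two_ne_zero) (pow_ne_zero ε (by norm_num))) := Units.ext htyp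
  rw [hu, SqrtNeg1.two_pow_mul_eleven_pow_mem_iff]

/-- **`K = ℚ(√-3)`, type `2^α 3^β 11^ε`, frame index a NORM: SPLIT iff `α` and `ε` are both even** — the `Dic₁₁` CM tenfold
of type `(1⁹, 11)` (`α = β = 0`, `ε = 1`; `ℚ(√-3) ↪ D₁₁` since `-3` is a non-square mod `11`) ⟹ NON-split row
`W10.3.11 = (5, ℚ(√-3), [-11])`.
research route conditional on HC_CM; not a corollary; Q11.4-sentence-2 already refuted in dim ≥ 3. [cite: vanGeemen1994HodgeAV, (5.4.1)] -/
theorem sqrtNeg3_mk_det_eq_split_iff_even_of_type_two_three_eleven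
    {a b : Matrix (Fin (2 * n)) (Fin (2 * n)) ℚ} (hd : IsPolarizationType Φ ω dtyp)
    (e : Fin (4 * n) ≃ ι) (P : Matrix (Fin (4 * n)) (Fin (4 * n)) ℤ)
    (hF : (Matrix.of fun j j' =>
        ω ![Φ (intVec fun i => P (e.symm i) j), Φ (intVec fun i => P (e.symm i) j')]) =
      (weilStdGramMatrix n 3 a b).map (Rat.cast : ℚ → ℝ))
    (ha : a.IsSymm) (hb : bᵀ = -b) (hq : (weilGramMatrix 3 a b).det = algebraMap ℚ (weilField 3) q)
    (hsign : 0 < (-1 : ℚ) ^ n * q) (hq0 : q ≠ 0) (hP : (P.det.natAbs : ℚ) ≠ 0)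
    (hidx : Units.mk0 (P.det.natAbs : ℚ) hP ∈ normUnitsSubgroup ℚ (weilField 3))
    {α β ε : ℕ} (htyp : (∏ i, (dtyp i : ℚ)) = 2 ^ α * 3 ^ β * 11 ^ ε) :
    (QuotientGroup.mk (Units.mk0 q hq0) : weilNormResidueGroup 3) = splitDiscriminantClass n 3 ↔
      Even α ∧ Even ε := by
  have hne : (2 : ℚ) ^ α * 3 ^ β * 11 ^ ε ≠ 0 :=
    mul_ne_zero (mul_ne_zero (pow_ne_zero α two_ne_zero) (pow_ne_zero β three_ne_zero))
      (pow_ne_zero ε (by norm_num))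
  have hprod : (∏ i, (dtyp i : ℚ)) ≠ 0 := by rw [htyp]; exact hne
  rw [mk_det_eq_splitDiscriminantClass_iff_prod_type_mem_of_index_mem hd (by norm_num) e P hF ha hb hq hsign
    hq0 hP hidx hprod]
  have hu : Units.mk0 (∏ i, (dtyp i : ℚ)) hprod = Units.mk0 ((2 : ℚ) ^ α * 3 ^ β * 11 ^ ε)
      (mul_ne_zero (mul_ne_zero (pow_ne_zero α two_ne_zero) (pow_ne_zero β three_ne_zero))
        (pow_ne_zero ε (by norm_num))) := Units.ext htyp
  rw [hu, SqrtNeg3.two_pow_mul_three_pow_mul_eleven_pow_mem_iff]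

/-- **`K = ℚ(√-2)`, type `2^α 3^β 13^ε`, frame index a NORM: SPLIT iff `ε` even** — the `Dic₁₃` CM twelvefold of type
`(1¹¹, 13)` (`ε = 1`; every imaginary quadratic field embeds in `D₁₃` since `13 ≡ 1 (mod 4)`) WOULD give the NON-split row
`W12.2.13 = (6, ℚ(√-2), [+13])` — but the hypothesis `hidx` (a norm-index INTEGRAL frame) is never met for `ℚ(√-2)` on `P₁₃`
(ERRATUM E-b04.9-1, ring2-b04 g46: 13-adic obstruction; the frame-free class of `P₁₃` is SPLIT for every `K`, row `W12.2.1`,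
`Ring2WeilCoverageFrameFreePlacement.twelvefold_dic13_mk_C_eq_split`). The conditional below is correct as stated.
research route conditional on HC_CM; not a corollary; Q11.4-sentence-2 already refuted in dim ≥ 3. [cite: vanGeemen1994HodgeAV, (5.4.1)] -/
theorem sqrtNeg2_mk_det_eq_split_iff_even_of_type_two_three_thirteen
    {a b : Matrix (Fin (2 * n)) (Fin (2 * n)) ℚ} (hd : IsPolarizationType Φ ω dtyp)
    (e : Fin (4 * n) ≃ ι) (P : Matrix (Fin (4 * n)) (Fin (4 * n)) ℤ)
    (hF : (Matrix.of fun j j' =>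
        ω ![Φ (intVec fun i => P (e.symm i) j), Φ (intVec fun i => P (e.symm i) j')]) =
      (weilStdGramMatrix n 2 a b).map (Rat.cast : ℚ → ℝ))
    (ha : a.IsSymm) (hb : bᵀ = -b) (hq : (weilGramMatrix 2 a b).det = algebraMap ℚ (weilField 2) q)
    (hsign : 0 < (-1 : ℚ) ^ n * q) (hq0 : q ≠ 0) (hP : (P.det.natAbs : ℚ) ≠ 0)
    (hidx : Units.mk0 (P.det.natAbs : ℚ) hP ∈ normUnitsSubgroup ℚ (weilField 2))
    {α β ε : ℕ} (htyp : (∏ i, (dtyp i : ℚ)) = 2 ^ α * 3 ^ β * 13 ^ ε) :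
    (QuotientGroup.mk (Units.mk0 q hq0) : weilNormResidueGroup 2) = splitDiscriminantClass n 2 ↔ Even ε := by
  have hne : (2 : ℚ) ^ α * 3 ^ β * 13 ^ ε ≠ 0 :=
    mul_ne_zero (mul_ne_zero (pow_ne_zero α two_ne_zero) (pow_ne_zero β three_ne_zero))
      (pow_ne_zero ε (by norm_num))
  have hprod : (∏ i, (dtyp i : ℚ)) ≠ 0 := by rw [htyp]; exact hne
  rw [mk_det_eq_splitDiscriminantClass_iff_prod_type_mem_of_index_mem hd (by norm_num) e P hF ha hb hq hsign
    hq0 hP hidx hprod]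
  have hu : Units.mk0 (∏ i, (dtyp i : ℚ)) hprod = Units.mk0 ((2 : ℚ) ^ α * 3 ^ β * 13 ^ ε)
      (mul_ne_zero (mul_ne_zero (pow_ne_zero α two_ne_zero) (pow_ne_zero β three_ne_zero))
        (pow_ne_zero ε (by norm_num))) := Units.ext htyp
  rw [hu, SqrtNeg2.two_pow_mul_three_pow_mul_thirteen_pow_mem_iff]

/-- **`K = ℚ(√-7)`, type `2^α 3^β 13^ε`, frame index a NORM: SPLIT iff `β` and `ε` are both even** — the `Dic₁₃` CM
twelvefold of type `(1¹¹, 13)` WOULD give `W12.7.13 = (6, ℚ(√-7), [+13])` under the (never met) hypothesis `hidx`; frame-free it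
lies on `W12.7.1` (ERRATUM E-b04.9-1, ring2-b04 g46; `Ring2WeilCoverageFrameFreePlacement.twelvefold_dic13_mk_C_eq_split`).
research route conditional on HC_CM; not a corollary; Q11.4-sentence-2 already refuted in dim ≥ 3. [cite: vanGeemen1994HodgeAV, (5.4.1)] -/
theorem sqrtNeg7_mk_det_eq_split_iff_even_of_type_two_three_thirteen
    {a b : Matrix (Fin (2 * n)) (Fin (2 * n)) ℚ} (hd : IsPolarizationType Φ ω dtyp)
    (e : Fin (4 * n) ≃ ι) (P : Matrix (Fin (4 * n)) (Fin (4 * n)) ℤ)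
    (hF : (Matrix.of fun j j' =>
        ω ![Φ (intVec fun i => P (e.symm i) j), Φ (intVec fun i => P (e.symm i) j')]) =
      (weilStdGramMatrix n 7 a b).map (Rat.cast : ℚ → ℝ))
    (ha : a.IsSymm) (hb : bᵀ = -b) (hq : (weilGramMatrix 7 a b).det = algebraMap ℚ (weilField 7) q)
    (hsign : 0 < (-1 : ℚ) ^ n * q) (hq0 : q ≠ 0) (hP : (P.det.natAbs : ℚ) ≠ 0)
    (hidx : Units.mk0 (P.det.natAbs : ℚ) hP ∈ normUnitsSubgroup ℚ (weilField 7))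
    {α β ε : ℕ} (htyp : (∏ i, (dtyp i : ℚ)) = 2 ^ α * 3 ^ β * 13 ^ ε) :
    (QuotientGroup.mk (Units.mk0 q hq0) : weilNormResidueGroup 7) = splitDiscriminantClass n 7 ↔
      Even β ∧ Even ε := by
  have hne : (2 : ℚ) ^ α * 3 ^ β * 13 ^ ε ≠ 0 :=
    mul_ne_zero (mul_ne_zero (pow_ne_zero α two_ne_zero) (pow_ne_zero β three_ne_zero))
      (pow_ne_zero ε (by norm_num))
  have hprod : (∏ i, (dtyp i : ℚ)) ≠ 0 := by rw [htyp]; exact hne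
  rw [mk_det_eq_splitDiscriminantClass_iff_prod_type_mem_of_index_mem hd (by norm_num) e P hF ha hb hq hsign
    hq0 hP hidx hprod]
  have hu : Units.mk0 (∏ i, (dtyp i : ℚ)) hprod = Units.mk0 ((2 : ℚ) ^ α * 3 ^ β * 13 ^ ε)
      (mul_ne_zero (mul_ne_zero (pow_ne_zero α two_ne_zero) (pow_ne_zero β three_ne_zero))
        (pow_ne_zero ε (by norm_num))) := Units.ext htyp
  rw [hu, SqrtNeg7.two_pow_mul_three_pow_mul_thirteen_pow_mem_iff]

end Census

end Summit.HodgeConjecture.HodgeConjecture.Ring2.WeilCoverage
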